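import Summits.ResolutionOfSingularities.ResolutionOfSingularities.Theorems.FrobeniusLadderFInjectiveMacaulayficationFDStorey2Specimen
import Summits.ResolutionOfSingularities.ResolutionOfSingularities.Theorems.FrobeniusLadderFInjectiveMacaulayficationGoodSupportDominated
import HarnessLib

/-!
# (W-TD) BED D, STOREY 2 (D-2), second file: the germ `G = Y₃² + Y₁³ + Y₂³ + (1+Y₃)(Y₄Y₅⁴ + Y₄²Y₅)` (char 2) is WEAKLY NON-DEGENERATE along every positive weight
# (crux `FInjectiveMacaulayfication` stmt-ResolutionOfSingularities-15315, chain w45a; res-L1-w45a-plan-1 RULING R21.15 (2) (D-2) «hWND on all 31 faces by a good-support/face-table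
# lemma»; seat res-L1-w45a-stub-3 g11; sequel of `…FDStorey2Specimen`, criterion `CensusBedsWeaklyNondegenerate.weaklyNondegenerate_of_good_support'` (✓ `…GoodSupportDominated`))

[OURS · L1 W4.5a] Support file (`--supports stmt-ResolutionOfSingularities-15315 --as helper`); def-free, unconditional; no named fact; NOT a statement of any manuscript.
AI-written (AI review is weaker than expert review).

* `f_eq_sum_monomial`, `support_subset` (⊆ the seven exponents), `vertex_mem_support` (`Y₄Y₅⁴`, `Y₄²Y₅` have coefficient 1);
* ★★ `weaklyNondegenerate_storey2` — β₀ = `Y₃²` (Jacobian-dead vertex); good: `Y₁³`, `Y₂³` (private odd), `Y₄Y₅⁴` via ∂_{Y₄} (competitors: `Y₄²Y₅` even, `Y₃Y₄Y₅⁴` dominated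
  by `Y₄Y₅⁴`, `Y₃Y₄²Y₅` even), `Y₄²Y₅` via ∂_{Y₅}; the two non-vertex monomials `Y₃Y₄Y₅⁴`, `Y₃Y₄²Y₅` are dominated. ⇒ the weak class row (B′) applies at `P` on
  Σ_G-refining cover data. [cite: BoubakriGreuelMarkwig2010, §3 (p. 10)]
-/

-- single-problem summit: the doubled namespace component is forced
set_option linter.dupNamespace false

noncomputable section

open MvPolynomial

namespace Summit.ResolutionOfSingularities.ResolutionOfSingularities.Theorems.FInjectiveMacaulayfication.FDStorey2Specimen

open Summit.ResolutionOfSingularities.ResolutionOfSingularities.Theorems.FInjectiveMacaulayfication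
open Literature.AlgebraicGeometry.Resolution Literature.AlgebraicGeometry.Resolution.BoubakriGreuelMarkwig

/-! ## §4 ★★ Weak non-degeneracy along every positive weight -/

/-- `f` as a sum of seven monomials. [plumbing] -/
theorem f_eq_sum_monomial (k : Type) [Field k] (f : MvPolynomial (Fin 5) k) (hf : f = X 2 ^ 2 + X 0 ^ 3 + X 1 ^ 3 + X 3 * X 4 ^ 4 + X 3 ^ 2 * X 4 + X 2 * X 3 * X 4 ^ 4 + X 2 * X 3 ^ 2 * X 4) :
    f = monomial (Finsupp.single 2 2) 1 + monomial (Finsupp.single 0 3) 1 + monomial (Finsupp.single 1 3) 1 +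
      monomial (Finsupp.single 3 1 + Finsupp.single 4 4) 1 + monomial (Finsupp.single 3 2 + Finsupp.single 4 1) 1 +
      monomial (Finsupp.single 2 1 + Finsupp.single 3 1 + Finsupp.single 4 4) 1 + monomial (Finsupp.single 2 1 + Finsupp.single 3 2 + Finsupp.single 4 1) 1 := by
  rw [hf]; simp only [X_pow_eq_monomial]; simp only [X, monomial_mul, mul_one]

/-- The support of `f` lies in the seven exponents. [plumbing] -/
theorem support_subset (k : Type) [Field k] (f : MvPolynomial (Fin 5) k) (hf : f = X 2 ^ 2 + X 0 ^ 3 + X 1 ^ 3 + X 3 * X 4 ^ 4 + X 3 ^ 2 * X 4 + X 2 * X 3 * X 4 ^ 4 + X 2 * X 3 ^ 2 * X 4) :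
    ∀ α ∈ f.support, α = Finsupp.single 2 2 ∨ α = Finsupp.single 0 3 ∨ α = Finsupp.single 1 3 ∨ α = Finsupp.single 3 1 + Finsupp.single 4 4 ∨
      α = Finsupp.single 3 2 + Finsupp.single 4 1 ∨ α = Finsupp.single 2 1 + Finsupp.single 3 1 + Finsupp.single 4 4 ∨
      α = Finsupp.single 2 1 + Finsupp.single 3 2 + Finsupp.single 4 1 := by
  classical
  intro α hα
  rw [f_eq_sum_monomial k f hf] at hα
  rcases Finset.mem_union.mp (support_add hα) with h | h
  · rcases CensusBedsWeaklyNondegenerate.mem_support_add6 h with h | h | h | h | h | h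
    · exact Or.inl (CensusBedsWeaklyNondegenerate.eq_of_mem_support_monomial h)
    · exact Or.inr (Or.inl (CensusBedsWeaklyNondegenerate.eq_of_mem_support_monomial h))
    · exact Or.inr (Or.inr (Or.inl (CensusBedsWeaklyNondegenerate.eq_of_mem_support_monomial h)))
    · exact Or.inr (Or.inr (Or.inr (Or.inl (CensusBedsWeaklyNondegenerate.eq_of_mem_support_monomial h))))
    · exact Or.inr (Or.inr (Or.inr (Or.inr (Or.inl (CensusBedsWeaklyNondegenerate.eq_of_mem_support_monomial h)))))
    · exact Or.inr (Or.inr (Or.inr (Or.inr (Or.inr (Or.inl (CensusBedsWeaklyNondegenerate.eq_of_mem_support_monomial h))))))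
  · exact Or.inr (Or.inr (Or.inr (Or.inr (Or.inr (Or.inr (CensusBedsWeaklyNondegenerate.eq_of_mem_support_monomial h))))))

/-- The two cured vertex monomials `Y₄Y₅⁴`, `Y₄²Y₅` do lie in the support (their coefficient is `1`). [plumbing] -/
theorem vertex_mem_support (k : Type) [Field k] (f : MvPolynomial (Fin 5) k) (hf : f = X 2 ^ 2 + X 0 ^ 3 + X 1 ^ 3 + X 3 * X 4 ^ 4 + X 3 ^ 2 * X 4 + X 2 * X 3 * X 4 ^ 4 + X 2 * X 3 ^ 2 * X 4) :
    (Finsupp.single 3 1 + Finsupp.single 4 4 : Fin 5 →₀ ℕ) ∈ f.support ∧ (Finsupp.single 3 2 + Finsupp.single 4 1 : Fin 5 →₀ ℕ) ∈ f.support := by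
  classical
  have ne : ∀ (α β : Fin 5 →₀ ℕ) (j : Fin 5), α j ≠ β j → α ≠ β := fun α β j h hab => h (by rw [hab])
  have d1 : (Finsupp.single 3 2 + Finsupp.single 4 1 : Fin 5 →₀ ℕ) ≠ Finsupp.single 3 1 + Finsupp.single 4 4 := ne _ _ 3 (by simp)
  have d2 : (Finsupp.single 2 1 + Finsupp.single 3 1 + Finsupp.single 4 4 : Fin 5 →₀ ℕ) ≠ Finsupp.single 3 1 + Finsupp.single 4 4 := ne _ _ 2 (by simp)
  have d3 : (Finsupp.single 2 1 + Finsupp.single 3 2 + Finsupp.single 4 1 : Fin 5 →₀ ℕ) ≠ Finsupp.single 3 1 + Finsupp.single 4 4 := ne _ _ 2 (by simp)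
  have d4 : (Finsupp.single 2 1 + Finsupp.single 3 1 + Finsupp.single 4 4 : Fin 5 →₀ ℕ) ≠ Finsupp.single 3 2 + Finsupp.single 4 1 := ne _ _ 2 (by simp)
  have d5 : (Finsupp.single 2 1 + Finsupp.single 3 2 + Finsupp.single 4 1 : Fin 5 →₀ ℕ) ≠ Finsupp.single 3 2 + Finsupp.single 4 1 := ne _ _ 2 (by simp)
  have d6 : (Finsupp.single 3 1 + Finsupp.single 4 4 : Fin 5 →₀ ℕ) ≠ Finsupp.single 3 2 + Finsupp.single 4 1 := ne _ _ 3 (by simp)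
  have d7 : (Finsupp.single 2 2 : Fin 5 →₀ ℕ) ≠ Finsupp.single 3 1 + Finsupp.single 4 4 := ne _ _ 2 (by simp)
  have d8 : (Finsupp.single 0 3 : Fin 5 →₀ ℕ) ≠ Finsupp.single 3 1 + Finsupp.single 4 4 := ne _ _ 0 (by simp)
  have d9 : (Finsupp.single 1 3 : Fin 5 →₀ ℕ) ≠ Finsupp.single 3 1 + Finsupp.single 4 4 := ne _ _ 1 (by simp)
  have d10 : (Finsupp.single 2 2 : Fin 5 →₀ ℕ) ≠ Finsupp.single 3 2 + Finsupp.single 4 1 := ne _ _ 2 (by simp)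
  have d11 : (Finsupp.single 0 3 : Fin 5 →₀ ℕ) ≠ Finsupp.single 3 2 + Finsupp.single 4 1 := ne _ _ 0 (by simp)
  have d12 : (Finsupp.single 1 3 : Fin 5 →₀ ℕ) ≠ Finsupp.single 3 2 + Finsupp.single 4 1 := ne _ _ 1 (by simp)
  constructor <;> rw [MvPolynomial.mem_support_iff, f_eq_sum_monomial k f hf]
  · simp [coeff_monomial, d1, d2, d3, d7, d8, d9]
  · simp [coeff_monomial, d4, d5, d6, d10, d11, d12]

/-- ★★ **THE STOREY-2 GERM IS WEAKLY NON-DEGENERATE ALONG EVERY POSITIVE WEIGHT** (`β₀ = Y₃²`, the Jacobian-dead vertex; the other four vertices are good in the relaxed sense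
of `weaklyNondegenerate_of_good_support'`; the two non-vertex monomials are dominated by `Y₄Y₅⁴`, `Y₄²Y₅`). [OURS · elementary certificate; cite: BoubakriGreuelMarkwig2010, §3] -/
theorem weaklyNondegenerate_storey2 (k : Type) [Field k] [CharP k 2] (f : MvPolynomial (Fin 5) k) (hf : f = X 2 ^ 2 + X 0 ^ 3 + X 1 ^ 3 + X 3 * X 4 ^ 4 + X 3 ^ 2 * X 4 + X 2 * X 3 * X 4 ^ 4 + X 2 * X 3 ^ 2 * X 4) :
    ∀ w : Fin 5 → ℝ, (∀ i, 0 < w i) → IsWeaklyNondegenerateAlong w (f : MvPowerSeries (Fin 5) k) := by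
  classical
  obtain ⟨hm14, hm21⟩ := vertex_mem_support k f hf
  have hsupp := support_subset k f hf
  have h2 : (2 : k) = 0 := by simpa using CensusBedsWeaklyNondegenerate.natCast_eq_zero_of_dvd (k := k) 2 2 dvd_rfl
  have h3 : ((3 : ℕ) : k) ≠ 0 := CensusBedsWeaklyNondegenerate.natCast_ne_zero_of_not_dvd 2 3 (by norm_num)
  have h4 : (4 : k) = 0 := by simpa using CensusBedsWeaklyNondegenerate.natCast_eq_zero_of_dvd (k := k) 2 4 (by norm_num)
  have dom14 : ∃ γ ∈ f.support, γ ≤ (Finsupp.single 2 1 + Finsupp.single 3 1 + Finsupp.single 4 4 : Fin 5 →₀ ℕ) ∧ γ ≠ Finsupp.single 2 1 + Finsupp.single 3 1 + Finsupp.single 4 4 :=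
    ⟨_, hm14, fun j => by fin_cases j <;> simp, fun h => by have := DFunLike.congr_fun h 2; simp at this⟩
  have dom21 : ∃ γ ∈ f.support, γ ≤ (Finsupp.single 2 1 + Finsupp.single 3 2 + Finsupp.single 4 1 : Fin 5 →₀ ℕ) ∧ γ ≠ Finsupp.single 2 1 + Finsupp.single 3 2 + Finsupp.single 4 1 :=
    ⟨_, hm21, fun j => by fin_cases j <;> simp, fun h => by have := DFunLike.congr_fun h 2; simp at this⟩
  refine CensusBedsWeaklyNondegenerate.weaklyNondegenerate_of_good_support' f (prime_f k f hf).ne_zero (Finsupp.single 2 2) (fun α hα hne => ?_)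
  rcases hsupp α hα with rfl | rfl | rfl | rfl | rfl | rfl | rfl
  · exact (hne rfl).elim
  · refine Or.inr ⟨0, by simpa using h3, fun β hβ hβne => ?_⟩
    rcases hsupp β hβ with rfl | rfl | rfl | rfl | rfl | rfl | rfl
    · exact Or.inl (by simp)
    · exact (hβne rfl).elim
    · exact Or.inl (by simp)
    · exact Or.inl (by simp)
    · exact Or.inl (by simp)
    · exact Or.inl (by simp)
    · exact Or.inl (by simp)
  · refine Or.inr ⟨1, by simpa using h3, fun β hβ hβne => ?_⟩
    rcases hsupp β hβ with rfl | rfl | rfl | rfl | rfl | rfl | rfl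
    · exact Or.inl (by simp)
    · exact Or.inl (by simp)
    · exact (hβne rfl).elim
    · exact Or.inl (by simp)
    · exact Or.inl (by simp)
    · exact Or.inl (by simp)
    · exact Or.inl (by simp)
  · refine Or.inr ⟨3, by simp, fun β hβ hβne => ?_⟩
    rcases hsupp β hβ with rfl | rfl | rfl | rfl | rfl | rfl | rfl
    · exact Or.inl (by simp)
    · exact Or.inl (by simp)
    · exact Or.inl (by simp)
    · exact (hβne rfl).elim
    · exact Or.inl (by simp [h2])
    · exact Or.inr dom14
    · exact Or.inl (by simp [h2])
  · refine Or.inr ⟨4, by simp, fun β hβ hβne => ?_⟩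
    rcases hsupp β hβ with rfl | rfl | rfl | rfl | rfl | rfl | rfl
    · exact Or.inl (by simp)
    · exact Or.inl (by simp)
    · exact Or.inl (by simp)
    · exact Or.inl (by simp [h4])
    · exact (hβne rfl).elim
    · exact Or.inl (by simp [h4])
    · exact Or.inr dom21
  · exact Or.inl dom14
  · exact Or.inl dom21

end Summit.ResolutionOfSingularities.ResolutionOfSingularities.Theorems.FInjectiveMacaulayfication.FDStorey2Specimen

end
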